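import Mathlib
import Literature.MathematicalPhysics.QuantumFieldTheory.Balaban1983to89.B14Eq316
import Literature.MathematicalPhysics.QuantumFieldTheory.Balaban1983to89.B14Sect3

/-!
# `Balaban1983to89.B14Eq322Analytic` — T. Bałaban, *Convergent renormalization expansions for lattice gauge theories*,
# Commun. Math. Phys. **119** (1988) 243–285 [Balaban1988Convergent]: the two clauses printed after (3.22) p. 269 —
# *"𝐇^{(k)} is an analytic function of the background field U_{k+1} …, bounded on the set S_{k+1} by O(1)ε_k exp(−R_k),
# hence by any positive power of g_k"* — PROVED for the typed `𝐇^{(k)}` of `B14Eq316` (`B14.Eq316.bH`)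

statement-level skeleton of published theorems with citation tags; proofs where landed; nothing here is a claim about the Yang–Mills mass gap

PDF held: `paper:balaban1988-cmp119-convergent-renormalization` (journal page = PDF page + 242); p. 269 read on the x2 render
`…-p027-x2.png` of `run/shared/lean/pub/pub-balaban/b2b-balaban-ref1/pages/1988-cmp119-convergent-renormalization/`.

CITATION HEADER (lean-in-tree rule).  WHAT IS REPRODUCED, verbatim, p. 269 [PDF 27]: *"Denoting
V^{(k)}(V^{(k)}_{Λᶜ_{k+1}∩Λ_k})⁻¹ = exp i𝐇^{(k)}, (3.22) we obtain that 𝐇^{(k)} is an analytic function of the background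
field U_{k+1} restricted to Λᶜ_{k+1}∩Λ_k, bounded on the set S_{k+1} by O(1)ε_k exp(−R_k), hence by any positive power of
g_k."* — SKELETON row **B14.Eq3.21–3.22**, whose (3.22) was typed by `B14Eq316` (p243442) as
`B14.Eq316.bH V W = (1/i) log(V W⁻¹)` with `exp_I_smul_bH` and the size transfer `norm_bH_le`, the two quoted clauses
being listed there as *"NOT typed"*.  They are PROVED here as the printed mechanism:

* ANALYTICITY (`analyticAt_bH`, `analyticOnNhd_bH`): if the two configurations `V = V^{(k)}(b)` and
  `W = V^{(k)}_{Λᶜ_{k+1}∩Λ_k}(b)` are analytic functions of a parameter `u` (the background field `U_{k+1}`, in any complex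
  normed space `E` of parameters — the analyticity of the minimal configurations in the background field is the input from
  [15], rows B11.Thm1/B11.Eq190, an explicit hypothesis) with values in the units of a complete normed `ℂ`-algebra `𝔸`, and
  `‖V W⁻¹ − 1‖ < 1` at `u` (inside the convergence disc of the logarithm (21) of [12]), then `u ↦ 𝐇^{(k)}(b)` is analytic at
  `u`: inversion is analytic on units (Mathlib `analyticAt_inverse`), the product is analytic, and `log` is analytic on
  `‖X − 1‖ < 1` (`MatrixLog.analyticAt_mlog`).
* THE BOUND (`norm_bH_le_O1`): from the representation (3.18)-type smallness `‖V W⁻¹ − 1‖ ≤ C ε_k e^{−R_k} ≤ ½` (the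
  input *"with similar bounds"* of p. 269, an explicit hypothesis) one gets `‖𝐇^{(k)}(b)‖ ≤ 2C ε_k e^{−R_k}` — the printed
  `O(1) = 2C`; and *"hence by any positive power of g_k"* (`norm_bH_le_pow`) by the (2.5) arithmetic
  `e^{−R_k} ≤ g_k^{2N}` of `B14Sect3.exp_neg_R_le_pow`.

Mega-formalization `lit-balaban`, unit `lit-balaban-r11` gen 4 (B14 fold owner; the «NOT typed» clauses of row
B14.Eq3.21–3.22), HOME `run/shared/lean/pub/lit-balaban/`.

## References
* [Balaban1988Convergent] T. Bałaban, Commun. Math. Phys. 119 (1988) 243–285, (3.22) and the sentence after it, p. 269;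
  (2.5) p. 255.
* [Balaban1985Averaging] T. Bałaban, Commun. Math. Phys. 98 (1985) 17–51, (21) p. 22 (the logarithm series; [12] of B14).
* [Balaban1985Variational] T. Bałaban, Commun. Math. Phys. 102 (1985) 277–309 ([15] of B14: analyticity of the minimizers).
-/

noncomputable section

namespace Literature.MathematicalPhysics.QuantumFieldTheory.Balaban1983to89.B14.Eq322Analytic

open Literature.MathematicalPhysics.QuantumFieldTheory.Balaban1983to89
open Literature.MathematicalPhysics.QuantumFieldTheory.Balaban1983to89.B14.Eq316
open MatrixLog

variable {𝔸 : Type*} [NormedRing 𝔸] [NormedAlgebra ℂ 𝔸] [CompleteSpace 𝔸]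
variable {E : Type*} [NormedAddCommGroup E] [NormedSpace ℂ E]

/-! ## §1. *"𝐇^{(k)} is an analytic function of the background field U_{k+1}"* -/

omit [NormedAlgebra ℂ 𝔸] [CompleteSpace 𝔸] in
/-- `V W⁻¹` as an `𝔸`-valued expression: `↑(V W⁻¹) = ↑V · inverse(↑W)` (`Ring.inverse` agrees with the group inverse on
units). [cite: Balaban1988Convergent, (3.22) p.269] -/
theorem val_mul_inv_eq (V W : 𝔸ˣ) : ((V * W⁻¹ : 𝔸ˣ) : 𝔸) = (V : 𝔸) * Ring.inverse (W : 𝔸) := by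
  rw [Units.val_mul, Ring.inverse_unit]

/-- The ratio `u ↦ V(u) W(u)⁻¹` of two unit-valued analytic configurations is analytic (inversion is analytic on the units
of a complete normed algebra). [cite: Balaban1988Convergent, (3.22) p.269] -/
theorem analyticAt_ratio {V W : E → 𝔸ˣ} {u : E} (hV : AnalyticAt ℂ (fun v => (V v : 𝔸)) u)
    (hW : AnalyticAt ℂ (fun v => (W v : 𝔸)) u) :
    AnalyticAt ℂ (fun v => ((V v * (W v)⁻¹ : 𝔸ˣ) : 𝔸)) u := by
  simp_rw [val_mul_inv_eq]
  exact hV.mul ((analyticAt_inverse (W u)).comp_of_eq hW rfl)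

/-- **p. 269 after (3.22), first clause, PROVED**: *"𝐇^{(k)} is an analytic function of the background field U_{k+1}"* —
if `V^{(k)}(b) = V u` and `V^{(k)}_{Λᶜ_{k+1}∩Λ_k}(b) = W u` depend analytically on the parameter `u` (the background field;
[15]) and `‖V W⁻¹ − 1‖ < 1` at `u`, then `u ↦ 𝐇^{(k)}(b) = bH (V u) (W u)` is analytic at `u`.
[cite: Balaban1988Convergent, (3.22) p.269] -/
theorem analyticAt_bH {V W : E → 𝔸ˣ} {u : E} (hV : AnalyticAt ℂ (fun v => (V v : 𝔸)) u)
    (hW : AnalyticAt ℂ (fun v => (W v : 𝔸)) u) (h1 : ‖((V u * (W u)⁻¹ : 𝔸ˣ) : 𝔸) - 1‖ < 1) :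
    AnalyticAt ℂ (fun v => bH (V v) (W v)) u := by
  unfold bH
  have hc : AnalyticAt ℂ (fun _ : E => (Complex.I : ℂ)⁻¹) u := analyticAt_const
  exact hc.smul ((analyticAt_mlog h1).comp_of_eq (analyticAt_ratio hV hW) rfl)

/-- The same on a set of parameters (the background fields `U_{k+1}` restricted to `Λᶜ_{k+1}∩Λ_k` for which the (3.18)-type
smallness holds): `𝐇^{(k)}(b)` is analytic on a neighbourhood of every point of `S`. [cite: Balaban1988Convergent, (3.22) p.269] -/
theorem analyticOnNhd_bH {V W : E → 𝔸ˣ} {S : Set E} (hV : AnalyticOnNhd ℂ (fun v => (V v : 𝔸)) S)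
    (hW : AnalyticOnNhd ℂ (fun v => (W v : 𝔸)) S) (h1 : ∀ u ∈ S, ‖((V u * (W u)⁻¹ : 𝔸ˣ) : 𝔸) - 1‖ < 1) :
    AnalyticOnNhd ℂ (fun v => bH (V v) (W v)) S :=
  fun u hu => analyticAt_bH (hV u hu) (hW u hu) (h1 u hu)

/-- Bondwise family version: for a finite or infinite family of bonds `b`, each `u ↦ 𝐇^{(k)}(b)(u)` is analytic on `S`, hence
so is the configuration-valued map `u ↦ (𝐇^{(k)}(b)(u))_b` into the product (pointwise analyticity of every coordinate is
what the later expansions use). [cite: Balaban1988Convergent, (3.22) p.269] -/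
theorem analyticOnNhd_bH_family {β : Type*} {V W : β → E → 𝔸ˣ} {S : Set E}
    (hV : ∀ b, AnalyticOnNhd ℂ (fun v => (V b v : 𝔸)) S) (hW : ∀ b, AnalyticOnNhd ℂ (fun v => (W b v : 𝔸)) S)
    (h1 : ∀ b, ∀ u ∈ S, ‖((V b u * (W b u)⁻¹ : 𝔸ˣ) : 𝔸) - 1‖ < 1) (b : β) :
    AnalyticOnNhd ℂ (fun v => bH (V b v) (W b v)) S :=
  analyticOnNhd_bH (hV b) (hW b) (h1 b)

/-! ## §2. *"bounded on the set S_{k+1} by O(1)ε_k exp(−R_k), hence by any positive power of g_k"* -/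

/-- **p. 269 after (3.22), second clause, PROVED**: if on `S_{k+1}` the representation (3.18) gives
`‖V^{(k)}(V^{(k)}_{Λᶜ∩Λ_k})⁻¹(b) − 1‖ ≤ C ε_k e^{−R_k}` with `C ε_k e^{−R_k} ≤ ½` (the printed input *"with similar
bounds"*), then `‖𝐇^{(k)}(b)‖ ≤ 2C ε_k e^{−R_k}` — *"bounded on the set S_{k+1} by O(1)ε_k exp(−R_k)"* with `O(1) = 2C`.
[cite: Balaban1988Convergent, (3.22) p.269] -/
theorem norm_bH_le_O1 (V W : 𝔸ˣ) {C ε R : ℝ} (h : ‖((V * W⁻¹ : 𝔸ˣ) : 𝔸) - 1‖ ≤ C * ε * Real.exp (-R))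
    (hs : C * ε * Real.exp (-R) ≤ 1 / 2) :
    ‖bH V W‖ ≤ 2 * C * ε * Real.exp (-R) := by
  have := norm_bH_le V W (h.trans hs)
  linarith

/-- *"hence by any positive power of g_k"*: with (2.5) (`R_k ≥ (log g_k⁻²)^r`, `r ≥ 1`) and `N ≤ (log g_k⁻²)^{r−1}`,
`e^{−R_k} ≤ g_k^{2N}` (`B14Sect3.exp_neg_R_le_pow`), so `‖𝐇^{(k)}(b)‖ ≤ 2C ε_k g_k^{2N}` for `0 < g_k < 1`, `C, ε_k ≥ 0`.
[cite: Balaban1988Convergent, (3.22) p.269] -/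
theorem norm_bH_le_pow (V W : 𝔸ˣ) {C ε R g : ℝ} {r N : ℕ} (hC : 0 ≤ C) (hε : 0 ≤ ε)
    (h : ‖((V * W⁻¹ : 𝔸ˣ) : 𝔸) - 1‖ ≤ C * ε * Real.exp (-R)) (hs : C * ε * Real.exp (-R) ≤ 1 / 2)
    (hg : 0 < g) (hg1 : g < 1) (hr : 1 ≤ r) (hR : (Real.log (g ^ 2)⁻¹) ^ r ≤ R)
    (hN : (N : ℝ) ≤ (Real.log (g ^ 2)⁻¹) ^ (r - 1)) :
    ‖bH V W‖ ≤ 2 * C * ε * g ^ (2 * N) := by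
  have h1 := norm_bH_le_O1 V W h hs
  have h2 : Real.exp (-R) ≤ g ^ (2 * N) := B14Sect3.exp_neg_R_le_pow g R r N hg hg1 hr hR hN
  have hCε : 0 ≤ 2 * C * ε := by positivity
  calc ‖bH V W‖ ≤ 2 * C * ε * Real.exp (-R) := h1
    _ ≤ 2 * C * ε * g ^ (2 * N) := mul_le_mul_of_nonneg_left h2 hCε

omit [NormedAddCommGroup E] [NormedSpace ℂ E] in
/-- Uniform version on the set `S_{k+1}` of parameters: a uniform (3.18)-type bound on `S` gives the uniform bound
`sup_{u∈S} ‖𝐇^{(k)}(b)(u)‖ ≤ 2C ε_k e^{−R_k}`. [cite: Balaban1988Convergent, (3.22) p.269] -/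
theorem norm_bH_le_O1_on {V W : E → 𝔸ˣ} {S : Set E} {C ε R : ℝ}
    (h : ∀ u ∈ S, ‖((V u * (W u)⁻¹ : 𝔸ˣ) : 𝔸) - 1‖ ≤ C * ε * Real.exp (-R)) (hs : C * ε * Real.exp (-R) ≤ 1 / 2) :
    ∀ u ∈ S, ‖bH (V u) (W u)‖ ≤ 2 * C * ε * Real.exp (-R) :=
  fun u hu => norm_bH_le_O1 (V u) (W u) (h u hu) hs

end Literature.MathematicalPhysics.QuantumFieldTheory.Balaban1983to89.B14.Eq322Analytic
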